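import Summits.CriticalPhenomena.PercolationContinuityZ3.Theorems.PercNearOneGluingNoHeavyLowerTailSunflowerMultiPetalKempeVertexMonotone
import HarnessLib
import HarnessLib.Audit

/-!
# `NoHeavyLowerTail` (crux stmt-CriticalPhenomena-4575), Lemma B for graph clutters: VERTEX-DELETION MONOTONICITY of the two-terminal
# functional AT A COMMON NEIGHBOUR OF THE TERMINALS — proved

Support file (seat `prim-l12-p2` gen 42; `--supports stmt-CriticalPhenomena-4575`; companion of `…SunflowerMultiPetalKempeVertexMonotone`
(p421779: `kerTAbs`, `Tfun_sub_Tfun_induce_eq_sum_kerTAbs`, `@[conjecture] TfunVertexMonotone`) and `…KempeTwoTerminal` (p416807: `phiU`, Lemma B1)).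
No `sorry`; nothing is asserted about the crux.  Memo: run/shared/lean/prim/prim-l12/prim-l12-p2/FINDING-g42-VERTEX-MONOTONICITY.md §2b.

THEOREM (VM at a common neighbour; this file, unconditional).  If `y` is adjacent to both terminals `u ≠ v` then
`Tfun (G − y) u v ≤ Tfun G u v` (`Tfun_induce_le_of_adj_adj`) — the conjecture `TfunVertexMonotone` (p421779) holds at every common neighbour
of the terminals, whatever the rest of `N(y)` and of `G`.  Consequently `T(G;u,v) ≥ 0` whenever every other vertex is adjacent to both `u` and `v`
(`Tfun_nonneg_of_forall_adj_adj`; this contains the dense 'apex' family on which the census ratio `T(G)/T(G−y)` tends to `1`).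
PROOF.  `T(G) − T(G−y) = Σ_τ kerTAbs (type τ) (profile τ)` (p421779) and the profile `d` of `N(y)` has `d_0, d_1 ≥ 1` (the terminals).  A finite
check (`kerTAbs_accounting`) gives `kerTAbs t d ≥ crA + crB − dbA − dbB` for such `d`, where the only DEBITS are the colourings of type `(0,0,1)` whose
only `0`-coloured neighbour of `y` is `u` (`dbA`) resp. whose only `1`-coloured neighbour is `v` (`dbB`), and the CREDITS are the colourings of type
`(1,0,0)`/`(2,0,0)` resp. `(0,1,0)`/`(0,2,0)` with no `2`-coloured neighbour of `y` (`crA`, `crB`).  The global swap `Φ_u` (`0 ↔ 2` off `u`) maps the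
`dbA`-colourings injectively into the `crA`-colourings (`card_dbA_le_card_crA`: Lemma B1's injection plus the observation that it turns 'no `0`-neighbour
of `y` besides `u`' into 'no `2`-neighbour of `y`'), and the mirror swap `Φ_v` (`1 ↔ 2` off `v`, `phiV`) handles `dbB ↪ crB`.
-/

namespace Summit.CriticalPhenomena.PercolationContinuityZ3.Theorems.SunflowerPartition.Kempe

open Finset
open scoped Classical

/-! ## The mirror swap `Φ_v` -/

section PhiV

variable {V : Type*} [Fintype V] (G : SimpleGraph V) (v : V)

/-- `sw12 c = 0 ↔ c = 0`. [this work] -/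
theorem sw12_eq_zero_iff : ∀ c, sw12 c = 0 ↔ c = 0 := by decide

/-- `sw12 c = 2 ↔ c = 1`. [this work] -/
theorem sw12_eq_two_iff : ∀ c, sw12 c = 2 ↔ c = 1 := by decide

/-- `sw12 2 = 1`. [this work] -/
theorem sw12_two : sw12 2 = 1 := by decide

/-- The GLOBAL SWAP `Φ_v`: exchange the colours `1 ↔ 2` at every vertex except the terminal `v`. [this work] -/
noncomputable def phiV (σ : V → Fin 3) : V → Fin 3 := fun w => if w = v then σ w else sw12 (σ w)

omit [Fintype V] in
/-- `Φ_v` is an involution. [this work] -/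
theorem phiV_phiV (σ : V → Fin 3) : phiV v (phiV v σ) = σ := by
  funext w
  unfold phiV
  split_ifs with h
  · rfl
  · exact sw12_sw12 _

omit [Fintype V] in
/-- `Φ_v` away from `v`. [this work] -/
theorem phiV_of_ne (σ : V → Fin 3) {w : V} (hw : w ≠ v) : phiV v σ w = sw12 (σ w) := by
  unfold phiV; rw [if_neg hw]

omit [Fintype V] in
/-- `Φ_v` at `v`. [this work] -/
theorem phiV_self (σ : V → Fin 3) : phiV v σ v = σ v := by
  unfold phiV; rw [if_pos rfl]

/-- If `σ v = 1` and `σ` has no monochromatic edge of colour `0`, neither has `Φ_v σ`. [this work] -/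
theorem cnt_phiV_zero {σ : V → Fin 3} (hv : σ v = 1) (h0 : cnt G σ 0 = 0) : cnt G (phiV v σ) 0 = 0 := by
  unfold cnt at h0 ⊢
  rw [card_eq_zero] at h0 ⊢
  rw [eq_empty_iff_forall_notMem] at h0 ⊢
  intro e he
  induction e using Sym2.ind with
  | _ p q =>
    have hv' : phiV v σ v ≠ 0 := by rw [phiV_self, hv]; decide
    obtain ⟨hp, hq⟩ := ne_of_mem_monoCol G v he hv'
    rw [mk_mem_monoCol_iff, phiV_of_ne v σ hp, phiV_of_ne v σ hq, sw12_eq_zero_iff, sw12_eq_zero_iff] at he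
    exact h0 s(p, q) ((mk_mem_monoCol_iff G σ 0 p q).2 he)

/-- If `σ v = 1` and `σ` has no monochromatic edge of colour `1`, then `Φ_v σ` has none of colour `2`. [this work] -/
theorem cnt_phiV_two {σ : V → Fin 3} (hv : σ v = 1) (h1 : cnt G σ 1 = 0) : cnt G (phiV v σ) 2 = 0 := by
  unfold cnt at h1 ⊢
  rw [card_eq_zero] at h1 ⊢
  rw [eq_empty_iff_forall_notMem] at h1 ⊢
  intro e he
  induction e using Sym2.ind with
  | _ p q =>
    have hv' : phiV v σ v ≠ 2 := by rw [phiV_self, hv]; decide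
    obtain ⟨hp, hq⟩ := ne_of_mem_monoCol G v he hv'
    rw [mk_mem_monoCol_iff, phiV_of_ne v σ hp, phiV_of_ne v σ hq, sw12_eq_two_iff, sw12_eq_two_iff] at he
    exact h1 s(p, q) ((mk_mem_monoCol_iff G σ 1 p q).2 he)

/-- If `σ v = 1` and `σ` has a monochromatic edge of colour `2`, then `Φ_v σ` has one of colour `1`. [this work] -/
theorem cnt_phiV_one_pos {σ : V → Fin 3} (hv : σ v = 1) (h2 : cnt G σ 2 ≠ 0) : cnt G (phiV v σ) 1 ≠ 0 := by
  unfold cnt at h2 ⊢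
  rw [Ne, card_eq_zero, ← Ne, ← nonempty_iff_ne_empty] at h2 ⊢
  obtain ⟨e, he⟩ := h2
  induction e using Sym2.ind with
  | _ p q =>
    have hv' : σ v ≠ 2 := by rw [hv]; decide
    obtain ⟨hp, hq⟩ := ne_of_mem_monoCol G v he hv'
    rw [mk_mem_monoCol_iff] at he
    refine ⟨s(p, q), (mk_mem_monoCol_iff G _ 1 p q).2 ⟨he.1, ?_, ?_⟩⟩
    · rw [phiV_of_ne v σ hp, he.2.1, sw12_two]
    · rw [phiV_of_ne v σ hq, he.2.2, sw12_two]

end PhiV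

/-! ## Pointwise accounting for a profile with both terminal colours present (finite check) -/

/-- Debit indicator: type `(0,0,1)` and `u` is the only `0`-coloured neighbour of `y`. [this work] -/
def dbA (t d : CType) : ℤ := if t = (0, 0, 1) ∧ d.1 = 1 then 1 else 0

/-- Debit indicator: type `(0,0,1)` and `v` is the only `1`-coloured neighbour of `y`. [this work] -/
def dbB (t d : CType) : ℤ := if t = (0, 0, 1) ∧ d.2.1 = 1 then 1 else 0

/-- Credit indicator: type `(1,0,0)` or `(2,0,0)` and no `2`-coloured neighbour of `y`. [this work] -/
def crA (t d : CType) : ℤ := if (t = (1, 0, 0) ∨ t = (2, 0, 0)) ∧ d.2.2 = 0 then 1 else 0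

/-- Credit indicator: type `(0,1,0)` or `(0,2,0)` and no `2`-coloured neighbour of `y`. [this work] -/
def crB (t d : CType) : ℤ := if (t = (0, 1, 0) ∨ t = (0, 2, 0)) ∧ d.2.2 = 0 then 1 else 0

/-- **ACCOUNTING**: if both terminal colours occur on `N(y)`, the kernel dominates credits minus debits pointwise (finite check). [this work] -/
theorem kerTAbs_accounting : ∀ t d : CType, d.1 ≠ 0 → d.2.1 ≠ 0 →
    crA t d + crB t d - dbA t d - dbB t d ≤ kerTAbs t d := by decide

/-! ## The injections `Φ_u : dbA ↪ crA` and `Φ_v : dbB ↪ crB` -/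

section Inject

variable {V : Type*} [Fintype V] (G : SimpleGraph V) (y : V)

/-- If `u ∼ y` is coloured `0` and the profile records exactly one `0`-coloured neighbour of `y`, every other neighbour of `y` avoids `0`. [this work] -/
theorem ne_zero_of_prof_eq_one {τ : (({y}ᶜ : Set V)) → Fin 3} {u : ({y}ᶜ : Set V)} {c : Fin 3} (hu : G.Adj y u.1) (hτu : τ u = c)
    (hone : prof G y τ c = 1) {w : ({y}ᶜ : Set V)} (hw : G.Adj y w.1) (hwu : w ≠ u) : τ w ≠ c := by
  intro hwc
  unfold prof at hone
  obtain ⟨a, ha⟩ := card_eq_one.1 hone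
  have hu' : u ∈ (univ.filter fun w : ({y}ᶜ : Set V) => G.Adj y w.1 ∧ τ w = c) := by
    rw [mem_filter]; exact ⟨mem_univ _, hu, hτu⟩
  have hw' : w ∈ (univ.filter fun w : ({y}ᶜ : Set V) => G.Adj y w.1 ∧ τ w = c) := by
    rw [mem_filter]; exact ⟨mem_univ _, hw, hwc⟩
  rw [ha, mem_singleton] at hu' hw'
  exact hwu (hw'.trans hu'.symm)

/-- **`Φ_u` maps debits to credits**: the `(0,0,1)`-colourings with `u` the only `0`-coloured neighbour of `y` inject into the
`(1,0,0)/(2,0,0)`-colourings with no `2`-coloured neighbour of `y`. [this work] -/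
theorem card_dbA_le_card_crA (u v : ({y}ᶜ : Set V)) (huv : u ≠ v) (hyu : G.Adj y u.1) :
    ((univ.filter fun τ : (({y}ᶜ : Set V)) → Fin 3 => τ u = 0 ∧ τ v = 1).filter fun τ =>
        ctype (G.induce ({y}ᶜ : Set V)) τ = (0, 0, 1) ∧ (prof3 G y τ).1 = 1).card
      ≤ ((univ.filter fun τ : (({y}ᶜ : Set V)) → Fin 3 => τ u = 0 ∧ τ v = 1).filter fun τ =>
        (ctype (G.induce ({y}ᶜ : Set V)) τ = (1, 0, 0) ∨ ctype (G.induce ({y}ᶜ : Set V)) τ = (2, 0, 0)) ∧ (prof3 G y τ).2.2 = 0).card := by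
  set G' := G.induce ({y}ᶜ : Set V) with hG'
  refine card_le_card_of_injOn (phiU u) (fun σ hσ => ?_) (fun σ₁ _ σ₂ _ h => ?_)
  · rw [mem_coe, mem_filter, mem_filter] at hσ
    obtain ⟨⟨-, hu0, hv1⟩, ht, hp⟩ := hσ
    unfold ctype at ht
    simp only [Prod.mk.injEq] at ht
    obtain ⟨hc0, hc1, hc2⟩ := ht
    have h0 : cnt G' σ 0 = 0 := (eq_zero_iff_cap3 _).2 hc0
    have h1 : cnt G' σ 1 = 0 := (eq_zero_iff_cap3 _).2 hc1
    have h2 : cnt G' σ 2 ≠ 0 := by rw [(eq_one_iff_cap3 _).2 hc2]; decide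
    have hA : phiU u σ u = 0 := by rw [phiU_self, hu0]
    have hB : phiU u σ v = 1 := by rw [phiU_of_ne u σ huv.symm, hv1]; decide
    have hT1 : cap3 (cnt G' (phiU u σ) 1) = 0 := (eq_zero_iff_cap3 _).1 (cnt_phiU_one G' u hu0 h1)
    have hT2 : cap3 (cnt G' (phiU u σ) 2) = 0 := (eq_zero_iff_cap3 _).1 (cnt_phiU_two G' u hu0 h0)
    have hT0 : cap3 (cnt G' (phiU u σ) 0) ≠ 0 := fun h => cnt_phiU_zero_pos G' u hu0 h2 ((eq_zero_iff_cap3 _).2 h)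
    -- the profile: no neighbour of `y` is coloured `2` under `Φ_u σ`
    have hone : prof G y σ 0 = 1 := (eq_one_iff_cap3 _).2 hp
    have hP : (prof3 G y (phiU u σ)).2.2 = 0 := by
      show cap3 (prof G y (phiU u σ) 2) = 0
      rw [← eq_zero_iff_cap3]
      unfold prof
      rw [card_eq_zero, eq_empty_iff_forall_notMem]
      intro w hw
      rw [mem_filter] at hw
      obtain ⟨-, hyw, hw2⟩ := hw
      by_cases hwu : w = u
      · rw [hwu, hA] at hw2; exact absurd hw2 (by decide)
      · rw [phiU_of_ne u σ hwu, sw02_eq_two_iff] at hw2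
        exact ne_zero_of_prof_eq_one G y hyu hu0 hone hyw hwu hw2
    rw [mem_coe, mem_filter, mem_filter]
    have key : ∀ z : Fin 3, z ≠ 0 → (z, (0 : Fin 3), (0 : Fin 3)) = ((1 : Fin 3), 0, 0) ∨ (z, (0 : Fin 3), (0 : Fin 3)) = ((2 : Fin 3), 0, 0) := by
      decide
    refine ⟨⟨mem_univ _, hA, hB⟩, ?_, hP⟩
    rcases key _ hT0 with h | h
    · exact Or.inl (by unfold ctype; rw [hT1, hT2]; exact h)
    · exact Or.inr (by unfold ctype; rw [hT1, hT2]; exact h)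
  · have := congrArg (phiU u) h
    rwa [phiU_phiU, phiU_phiU] at this

/-- **`Φ_v` maps debits to credits** (mirror image). [this work] -/
theorem card_dbB_le_card_crB (u v : ({y}ᶜ : Set V)) (huv : u ≠ v) (hyv : G.Adj y v.1) :
    ((univ.filter fun τ : (({y}ᶜ : Set V)) → Fin 3 => τ u = 0 ∧ τ v = 1).filter fun τ =>
        ctype (G.induce ({y}ᶜ : Set V)) τ = (0, 0, 1) ∧ (prof3 G y τ).2.1 = 1).card
      ≤ ((univ.filter fun τ : (({y}ᶜ : Set V)) → Fin 3 => τ u = 0 ∧ τ v = 1).filter fun τ =>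
        (ctype (G.induce ({y}ᶜ : Set V)) τ = (0, 1, 0) ∨ ctype (G.induce ({y}ᶜ : Set V)) τ = (0, 2, 0)) ∧ (prof3 G y τ).2.2 = 0).card := by
  set G' := G.induce ({y}ᶜ : Set V) with hG'
  refine card_le_card_of_injOn (phiV v) (fun σ hσ => ?_) (fun σ₁ _ σ₂ _ h => ?_)
  · rw [mem_coe, mem_filter, mem_filter] at hσ
    obtain ⟨⟨-, hu0, hv1⟩, ht, hp⟩ := hσ
    unfold ctype at ht
    simp only [Prod.mk.injEq] at ht
    obtain ⟨hc0, hc1, hc2⟩ := ht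
    have h0 : cnt G' σ 0 = 0 := (eq_zero_iff_cap3 _).2 hc0
    have h1 : cnt G' σ 1 = 0 := (eq_zero_iff_cap3 _).2 hc1
    have h2 : cnt G' σ 2 ≠ 0 := by rw [(eq_one_iff_cap3 _).2 hc2]; decide
    have hA : phiV v σ u = 0 := by rw [phiV_of_ne v σ huv, hu0]; decide
    have hB : phiV v σ v = 1 := by rw [phiV_self, hv1]
    have hT0 : cap3 (cnt G' (phiV v σ) 0) = 0 := (eq_zero_iff_cap3 _).1 (cnt_phiV_zero G' v hv1 h0)
    have hT2 : cap3 (cnt G' (phiV v σ) 2) = 0 := (eq_zero_iff_cap3 _).1 (cnt_phiV_two G' v hv1 h1)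
    have hT1 : cap3 (cnt G' (phiV v σ) 1) ≠ 0 := fun h => cnt_phiV_one_pos G' v hv1 h2 ((eq_zero_iff_cap3 _).2 h)
    have hone : prof G y σ 1 = 1 := (eq_one_iff_cap3 _).2 hp
    have hP : (prof3 G y (phiV v σ)).2.2 = 0 := by
      show cap3 (prof G y (phiV v σ) 2) = 0
      rw [← eq_zero_iff_cap3]
      unfold prof
      rw [card_eq_zero, eq_empty_iff_forall_notMem]
      intro w hw
      rw [mem_filter] at hw
      obtain ⟨-, hyw, hw2⟩ := hw
      by_cases hwv : w = v
      · rw [hwv, hB] at hw2; exact absurd hw2 (by decide)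
      · rw [phiV_of_ne v σ hwv, sw12_eq_two_iff] at hw2
        exact ne_zero_of_prof_eq_one G y hyv hv1 hone hyw hwv hw2
    rw [mem_coe, mem_filter, mem_filter]
    have key : ∀ z : Fin 3, z ≠ 0 → ((0 : Fin 3), z, (0 : Fin 3)) = ((0 : Fin 3), 1, 0) ∨ ((0 : Fin 3), z, (0 : Fin 3)) = ((0 : Fin 3), 2, 0) := by
      decide
    refine ⟨⟨mem_univ _, hA, hB⟩, ?_, hP⟩
    rcases key _ hT1 with h | h
    · exact Or.inl (by unfold ctype; rw [hT0, hT2]; exact h)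
    · exact Or.inr (by unfold ctype; rw [hT0, hT2]; exact h)
  · have := congrArg (phiV v) h
    rwa [phiV_phiV, phiV_phiV] at this

end Inject

/-! ## The theorem -/

section Main

variable {V : Type*} [Fintype V] (G : SimpleGraph V) (y : V)

/-- **VERTEX-DELETION MONOTONICITY AT A COMMON NEIGHBOUR OF THE TERMINALS** (this work, unconditional): if `y ∼ u` and `y ∼ v` then
`Tfun (G − y) u v ≤ Tfun G u v`. [this work] -/
theorem Tfun_induce_le_of_adj_adj (u v : ({y}ᶜ : Set V)) (huv : u ≠ v) (hyu : G.Adj y u.1) (hyv : G.Adj y v.1) :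
    Tfun (G.induce ({y}ᶜ : Set V)) u v ≤ Tfun G u.1 v.1 := by
  set G' := G.induce ({y}ᶜ : Set V) with hG'
  set S := (univ.filter fun τ : (({y}ᶜ : Set V)) → Fin 3 => τ u = 0 ∧ τ v = 1) with hS
  rw [← sub_nonneg, Tfun_sub_Tfun_induce_eq_sum_kerTAbs]
  -- both terminal colours occur on N(y)
  have hprof : ∀ τ ∈ S, (prof3 G y τ).1 ≠ 0 ∧ (prof3 G y τ).2.1 ≠ 0 := by
    intro τ hτ
    obtain ⟨h0, h1⟩ := (mem_filter.1 hτ).2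
    have ne : ∀ (w : ({y}ᶜ : Set V)) (c : Fin 3), G.Adj y w.1 → τ w = c → cap3 (prof G y τ c) ≠ 0 := by
      intro w c hw hc habs
      have hz : prof G y τ c = 0 := (eq_zero_iff_cap3 _).2 habs
      unfold prof at hz
      rw [card_eq_zero, eq_empty_iff_forall_notMem] at hz
      exact hz w (by rw [mem_filter]; exact ⟨mem_univ _, hw, hc⟩)
    exact ⟨ne u 0 hyu h0, ne v 1 hyv h1⟩
  -- pointwise accounting, summed
  have hsum : ∑ τ ∈ S, (crA (ctype G' τ) (prof3 G y τ) + crB (ctype G' τ) (prof3 G y τ)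
      - dbA (ctype G' τ) (prof3 G y τ) - dbB (ctype G' τ) (prof3 G y τ))
      ≤ ∑ τ ∈ S, kerTAbs (ctype G' τ) (prof3 G y τ) :=
    sum_le_sum fun τ hτ => kerTAbs_accounting _ _ (hprof τ hτ).1 (hprof τ hτ).2
  refine le_trans ?_ hsum
  rw [sum_sub_distrib, sum_sub_distrib, sum_add_distrib]
  -- each indicator sum is a cardinality
  have eA : ∑ τ ∈ S, crA (ctype G' τ) (prof3 G y τ)
      = ((S.filter fun τ => (ctype G' τ = (1, 0, 0) ∨ ctype G' τ = (2, 0, 0)) ∧ (prof3 G y τ).2.2 = 0).card : ℤ) := by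
    unfold crA; rw [sum_boole]
  have eB : ∑ τ ∈ S, crB (ctype G' τ) (prof3 G y τ)
      = ((S.filter fun τ => (ctype G' τ = (0, 1, 0) ∨ ctype G' τ = (0, 2, 0)) ∧ (prof3 G y τ).2.2 = 0).card : ℤ) := by
    unfold crB; rw [sum_boole]
  have eDA : ∑ τ ∈ S, dbA (ctype G' τ) (prof3 G y τ)
      = ((S.filter fun τ => ctype G' τ = (0, 0, 1) ∧ (prof3 G y τ).1 = 1).card : ℤ) := by
    unfold dbA; rw [sum_boole]
  have eDB : ∑ τ ∈ S, dbB (ctype G' τ) (prof3 G y τ)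
      = ((S.filter fun τ => ctype G' τ = (0, 0, 1) ∧ (prof3 G y τ).2.1 = 1).card : ℤ) := by
    unfold dbB; rw [sum_boole]
  rw [eA, eB, eDA, eDB]
  have iA := card_dbA_le_card_crA G y u v huv hyu
  have iB := card_dbB_le_card_crB G y u v huv hyv
  rw [← hG', ← hS] at iA iB
  have iA' : ((S.filter fun τ => ctype G' τ = (0, 0, 1) ∧ (prof3 G y τ).1 = 1).card : ℤ)
      ≤ ((S.filter fun τ => (ctype G' τ = (1, 0, 0) ∨ ctype G' τ = (2, 0, 0)) ∧ (prof3 G y τ).2.2 = 0).card : ℤ) := by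
    exact_mod_cast iA
  have iB' : ((S.filter fun τ => ctype G' τ = (0, 0, 1) ∧ (prof3 G y τ).2.1 = 1).card : ℤ)
      ≤ ((S.filter fun τ => (ctype G' τ = (0, 1, 0) ∨ ctype G' τ = (0, 2, 0)) ∧ (prof3 G y τ).2.2 = 0).card : ℤ) := by
    exact_mod_cast iB
  linarith

/-- The unrestricted form: for `y ∉ {u,v}` adjacent to both terminals, `T(G−y;u,v) ≤ T(G;u,v)` with the terminals of `G − y` spelled out. [this work] -/
theorem Tfun_induce_le_of_adj_adj' {u v : V} (huv : u ≠ v) (hyu : G.Adj y u) (hyv : G.Adj y v) :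
    Tfun (G.induce ({y}ᶜ : Set V)) ⟨u, Set.mem_compl_singleton_iff.mpr (G.ne_of_adj hyu).symm⟩
        ⟨v, Set.mem_compl_singleton_iff.mpr (G.ne_of_adj hyv).symm⟩ ≤ Tfun G u v :=
  Tfun_induce_le_of_adj_adj G y _ _ (fun h => huv (congrArg Subtype.val h)) hyu hyv

end Main

/-- **COROLLARY (dominating terminals)**: if every vertex other than `u ≠ v` is adjacent to both `u` and `v`, then `T(G;u,v) ≥ 0` —
unconditionally (delete the common neighbours one at a time). [this work] -/
theorem Tfun_nonneg_of_forall_adj_adj :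
    ∀ (n : ℕ) (V : Type) [Fintype V] (G : SimpleGraph V) (u v : V), Fintype.card V = n → u ≠ v →
      (∀ w : V, w ≠ u → w ≠ v → G.Adj w u ∧ G.Adj w v) → 0 ≤ Tfun G u v := by
  intro n
  induction n using Nat.strong_induction_on with
  | _ n ih =>
    intro V _ G u v hn huv hdom
    by_cases hV : ∀ w : V, w = u ∨ w = v
    · rw [Tfun_eq_zero_of_forall_mem G hV]
    · push Not at hV
      obtain ⟨y, hyu, hyv⟩ := hV
      obtain ⟨hau, hav⟩ := hdom y hyu hyv
      let u' : ({y}ᶜ : Set V) := ⟨u, Set.mem_compl_singleton_iff.mpr (Ne.symm hyu)⟩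
      let v' : ({y}ᶜ : Set V) := ⟨v, Set.mem_compl_singleton_iff.mpr (Ne.symm hyv)⟩
      have huv' : u' ≠ v' := fun e => huv (congrArg Subtype.val e)
      have hcard : Fintype.card (({y}ᶜ : Set V)) = n - 1 := by
        rw [Fintype.card_compl_set, Set.card_singleton, hn]
      have hpos : 0 < n := by rw [← hn]; exact Fintype.card_pos_iff.mpr ⟨y⟩
      have hlt : n - 1 < n := Nat.sub_lt hpos Nat.one_pos
      have hdom' : ∀ w : ({y}ᶜ : Set V), w ≠ u' → w ≠ v' →
          (G.induce ({y}ᶜ : Set V)).Adj w u' ∧ (G.induce ({y}ᶜ : Set V)).Adj w v' := by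
        intro w hwu hwv
        have hwu1 : w.1 ≠ u := fun e => hwu (Subtype.ext e)
        have hwv1 : w.1 ≠ v := fun e => hwv (Subtype.ext e)
        obtain ⟨h1, h2⟩ := hdom w.1 hwu1 hwv1
        exact ⟨SimpleGraph.induce_adj.mpr h1, SimpleGraph.induce_adj.mpr h2⟩
      have h1 : 0 ≤ Tfun (G.induce ({y}ᶜ : Set V)) u' v' := ih (n - 1) hlt _ _ u' v' hcard huv' hdom'
      exact h1.trans (Tfun_induce_le_of_adj_adj G y u' v' huv' hau hav)

end Summit.CriticalPhenomena.PercolationContinuityZ3.Theorems.SunflowerPartition.Kempe
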